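import Summits.CriticalPhenomena.PercolationContinuityZ3.Theorems.PercAnnulusCrossingHarrisSlackDecoupling
import HarnessLib

/-!
# RSW3 lane (lead, gen 23): ANATOMY OF THE HARRIS SLACK, X — the critical annulus crossing of `ℤ^d` (every `d ≥ 2`) decouples from every
# bounded-influence observable, uniformly

builds on p205010 (kernel theorem, internal audit signed; external expert review pending) — USED (via part VI's pivotal renewal for the annulus,
resting on gen 20's `tendsto_annulus_noise_criticalProbI` and `θ(p_c) = 0` in every `d ≥ 2`).

Cell `prim-rsw3` (LANE 3), lead seat, gen 23.  Support file (`--supports stmt-CriticalPhenomena-4575`); no definitions, no named facts,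
no sorries.  Part VIII §2 in every dimension, for the aspect-2 annulus `Λ(L) ↔ ∂ⁱⁿΛ(2L)` read on the cube of `Λ(2L)` (`g_L = gcross`, `E_{p_c} g_L =
u_L = P_{p_c}(boxCrossing d L (2L)) ∈ [85^{−d}, 1]` by the tree's annulus floor — so here the variance does NOT degenerate):

* **`annulus_abs_cov_le_of_total_influence_le_criticalProbI`** — for every `d ≥ 2`, `K ≥ 0`, `η > 0` there is `L₀` such that for all `L ≥ L₀` and
  EVERY real `g` on the cube of `Λ(2L)` with `Σ_e b_e(1−b_e)E_{p_c}[(D_e g)²] ≤ K`: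
  **`|E_{p_c}[𝟙{Λ(L) ↔ ∂ⁱⁿΛ(2L)}·g] − u_L·E_{p_c}[g]| ≤ η`** — THE CRITICAL ANNULUS CROSSING OF `ℤ^d` IS ASYMPTOTICALLY INDEPENDENT OF EVERY
  BOUNDED-INFLUENCE OBSERVABLE (part VIII `abs_cov_le_of_total_influence_le` + part VI `tendsto_annulus_pivotal_autocorrelation_criticalProbI`).
  Gen 21's `annulus_abs_cov_linear_criticalProbI` was the linear case (weighted edge counts); here every observable of bounded total influence.

References: I. Benjamini, G. Kalai, O. Schramm, Publ. IHÉS 90 (1999) Thm 1.5; C. Garban, J. Steif, CUP 2014, Ch. V; H. Kesten (1982) §3.3 (annulus floor).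
-/

noncomputable section

namespace Summit.CriticalPhenomena.PercolationContinuityZ3.Theorems.Crossing

open MeasureTheory Finset Function Filter Topology
open Literature.Probability.Percolation Literature.Probability.LatticeModels
open Literature.Probability.ODonnellSaksSchrammServedio2005
open Literature.Probability.Percolation.GhostExploration Literature.Probability.Percolation.SeedExploration
open Literature.Probability.Percolation.OneArmOSSS Literature.Probability.Percolation.DCT16
open Summit.CriticalPhenomena.PercolationContinuityZ3.Theorems.SurfaceTension
open Summit.CriticalPhenomena.PercolationContinuityZ3.Theorems.CrossingRevealment
open Summit.CriticalPhenomena.PercolationContinuityZ3.Theorems.Crossing.Spectral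

variable {d : ℕ}

/-- **THE CRITICAL ANNULUS CROSSING OF `ℤ^d` IS ASYMPTOTICALLY INDEPENDENT OF EVERY BOUNDED-INFLUENCE OBSERVABLE, UNIFORMLY** (every `d ≥ 2`;
`g_L` the indicator of `Λ(L) ↔ ∂ⁱⁿΛ(2L)` read on the cube of `Λ(2L)`, `E_{p_c} g_L = P_{p_c}(boxCrossing d L (2L))`, `b = boxBias d (2L) p_c`): for every
`K ≥ 0` and `η > 0` there is `L₀` such that for all `L ≥ L₀` and every real `g` on the cube of `Λ(2L)` with `Σ_e b_e(1−b_e)E_{p_c}[(D_e g)²] ≤ K`,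
`|E_{p_c}[g_L·g] − P_{p_c}(boxCrossing d L (2L))·E_{p_c}[g]| ≤ η`. [cite: BenjaminiKalaiSchramm1999, Thm 1.5 and §1.4] [cite: GarbanSteif2014, Ch. V] -/
theorem annulus_abs_cov_le_of_total_influence_le_criticalProbI (hd : 2 ≤ d) {K : ℝ} (hK : 0 ≤ K) {η : ℝ} (hη : 0 < η) :
    ∃ L₀ : ℕ, ∀ L, L₀ ≤ L → ∀ g : (PairIdx d (2 * L) → Bool) → ℝ,
      (∑ e : PairIdx d (2 * L), boxBias d (2 * L) (criticalProbI d) e * (1 - boxBias d (2 * L) (criticalProbI d) e)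
          * ∑ x : PairIdx d (2 * L) → Bool, wt (boxBias d (2 * L) (criticalProbI d)) x * (g (update x e true) - g (update x e false)) ^ 2 ≤ K) →
      |∑ x : PairIdx d (2 * L) → Bool, wt (boxBias d (2 * L) (criticalProbI d)) x
            * (gcross (latEdge d (2 * L)) (sphereSeed d (2 * L) L) (sphereSeed d (2 * L) (2 * L)) x * g x)
          - (bondPercolation (zdGraph d) (criticalProbI d)).real (boxCrossing d L (2 * L))
            * ∑ x : PairIdx d (2 * L) → Bool, wt (boxBias d (2 * L) (criticalProbI d)) x * g x| ≤ η := by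
  classical
  have hd1 : 1 ≤ d := le_trans (by norm_num) hd
  obtain ⟨δ, hδ0, hδ1, hδ⟩ : ∃ δ : ℝ, 0 < δ ∧ δ ≤ 1 ∧ Real.sqrt δ / 2 * (1 + K) ≤ η / 2 := by
    refine ⟨min 1 ((η / (1 + K)) ^ 2), lt_min one_pos (by positivity), min_le_left _ _, ?_⟩
    have hs : Real.sqrt (min 1 ((η / (1 + K)) ^ 2)) ≤ η / (1 + K) := by
      calc Real.sqrt (min 1 ((η / (1 + K)) ^ 2)) ≤ Real.sqrt ((η / (1 + K)) ^ 2) := Real.sqrt_le_sqrt (min_le_right _ _)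
        _ = η / (1 + K) := Real.sqrt_sq (by positivity)
    have h1K : 0 < 1 + K := by linarith
    calc Real.sqrt (min 1 ((η / (1 + K)) ^ 2)) / 2 * (1 + K) ≤ (η / (1 + K)) / 2 * (1 + K) :=
          mul_le_mul_of_nonneg_right (div_le_div_of_nonneg_right hs (by norm_num)) h1K.le
      _ = η / 2 := by field_simp
  have hJ := tendsto_annulus_pivotal_autocorrelation_criticalProbI hd hδ0 hδ1
  have hε2 : 0 < (η / 2) ^ 2 / (K + 1) := by positivity
  obtain ⟨L₀, hL₀⟩ := (Metric.tendsto_atTop.1 hJ) ((η / 2) ^ 2 / (K + 1)) hε2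
  refine ⟨L₀, fun L hL g hg => ?_⟩
  set b := boxBias d (2 * L) (criticalProbI d) with hb
  set f : (PairIdx d (2 * L) → Bool) → ℝ := gcross (latEdge d (2 * L)) (sphereSeed d (2 * L) L) (sphereSeed d (2 * L) (2 * L)) with hf
  have hb0 : ∀ e, 0 ≤ b e := boxBias_nonneg (2 * L) (criticalProbI d).2.1
  have hb1 : ∀ e, b e ≤ 1 := boxBias_le_one (2 * L) (criticalProbI d).2.2
  have hmean : ∑ x : PairIdx d (2 * L) → Bool, wt b x * f x = (bondPercolation (zdGraph d) (criticalProbI d)).real (boxCrossing d L (2 * L)) :=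
    sum_wt_gcross_eq hd1 (by omega : L ≤ 2 * L) (criticalProbI d)
  have hmain := abs_cov_le_of_total_influence_le b hb0 hb1 f g hg hδ0 hδ1
  rw [hmean] at hmain
  refine hmain.trans ?_
  have hf01 : ∀ x, f x * f x = f x := by intro x; rw [hf]; unfold gcross; split_ifs <;> norm_num
  have hvar1 : ∑ x : PairIdx d (2 * L) → Bool, wt b x * (f x * f x)
      - ((bondPercolation (zdGraph d) (criticalProbI d)).real (boxCrossing d L (2 * L))) ^ 2 ≤ 1 := by
    simp only [hf01]
    rw [hmean]
    have hP1 : (bondPercolation (zdGraph d) (criticalProbI d)).real (boxCrossing d L (2 * L)) ≤ 1 := measureReal_le_one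
    nlinarith [sq_nonneg ((bondPercolation (zdGraph d) (criticalProbI d)).real (boxCrossing d L (2 * L)))]
  have hJL := hL₀ L hL
  rw [Real.dist_eq, sub_zero] at hJL
  have hJL' := (le_abs_self _).trans_lt hJL
  have hsqrt : Real.sqrt K * Real.sqrt (∑ e : PairIdx d (2 * L), b e * (1 - b e)
      * ∑ x : PairIdx d (2 * L) → Bool, ∑ y : PairIdx d (2 * L) → Bool, ∑ ν : PairIdx d (2 * L) → Bool,
          wt b x * wt b y * wt (fun _ => δ) ν
          * ((f (update x e true) - f (update x e false))
            * (f (update (fun j => if ν j = true then y j else x j) e true)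
              - f (update (fun j => if ν j = true then y j else x j) e false)))) ≤ η / 2 := by
    rw [← Real.sqrt_mul hK]
    refine (Real.sqrt_le_sqrt (mul_le_mul_of_nonneg_left hJL'.le hK)).trans ?_
    have hle : K * ((η / 2) ^ 2 / (K + 1)) ≤ (η / 2) ^ 2 := by
      rw [mul_div_assoc']
      refine (div_le_iff₀ (by linarith)).2 ?_
      nlinarith [sq_nonneg (η / 2)]
    calc Real.sqrt (K * ((η / 2) ^ 2 / (K + 1))) ≤ Real.sqrt ((η / 2) ^ 2) := Real.sqrt_le_sqrt hle
      _ = η / 2 := Real.sqrt_sq (by positivity)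
  have hfirst : Real.sqrt δ / 2 * ((∑ x : PairIdx d (2 * L) → Bool, wt b x * (f x * f x)
      - ((bondPercolation (zdGraph d) (criticalProbI d)).real (boxCrossing d L (2 * L))) ^ 2) + K) ≤ η / 2 :=
    le_trans (mul_le_mul_of_nonneg_left (by linarith [hvar1]) (by positivity)) hδ
  linarith [hfirst, hsqrt]

end Summit.CriticalPhenomena.PercolationContinuityZ3.Theorems.Crossing

end
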